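import Summits.ValiantsHypothesis.ValiantsHypothesis.Theorems.PolyaContinuedSignedCoverLittleTransferCircuits
import Summits.ValiantsHypothesis.ValiantsHypothesis.Theorems.PolyaContinuedSignedCoverLittleNormalForm
import Summits.ValiantsHypothesis.ValiantsHypothesis.Theorems.PolyaContinuedSignedCoverLittleKstd
import HarnessLib

/-!
# Route PolyaContinued — support item `SignedCoverLittle` (stmt-ValiantsHypothesis-7426):
# the H-side pipeline for the standard target (set-up of stub `stub_even`, line `even_induction`)

Glue between the lead's line `even_induction` (Cruxes/SignedCoverLittle/Lines: after `stub_chain`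
the label identity is onto a relabelling `relabel (kstd n) ρ κ` of the standard target
`K_{3,3} ⊔ diagonal`) and the H-side steps of `proof-LabelTransfer.md`:

* `exists_normalForm_kstd` (G1) — normalise (`exists_normalForm_of_isPerfectMatching` with the
  reference matching `κ ρ⁻¹`): the new source `H'` contains the diagonal, `φ' (x, x) = (x, x)`,
  the new target is `relabel (kstd n) ρ ρ` = `K_{3,3}` on `A = ρ {0,1,2}` plus the diagonal
  (`mem_relabel_filter_kstd_iff`), `H` is Pfaffian iff `H'` is, and cell multiplicities transfer;
* in the normalised setting (label identity onto a graph of shape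
  `(x, y) ∈ E ↔ (x ∈ A ∧ y ∈ A) ∨ x = y`, `#A = 3`; diagonal inside `H`; `φ (x, x) = (x, x)`):
  `card_filter_ne_one_eq_five` (G2a: `D(H)` has exactly five dicircuits = the non-identity perfect
  matchings), `isCycle_of_isPerfectMatching_of_ne_one`, `isCycle_inv_mul_of_isPerfectMatching`
  (pairwise single cycles), `mem_filter_of_isCycle_of_forall_apply` (splice closure: a cyclic
  permutation moving points only along two dicircuits is one of the five), and
  `exists_lifted_fork_pair` (G2b: the lifts `γ₊, γ₋` of the two `3`-cycles of the target — distinct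
  dicircuits whose images have `≥ 3` forks; with the (CS) count of the ear-lemma file this gives
  `≥ 3` forks of `γ₊, γ₋`, the input of the two-circuit ear lemma).

* `even_multiplicity_of_even_cover` (G3) — with an odd number of dicircuits, even coverage of the
  off-diagonal cells by the dicircuits gives even multiplicity of EVERY cell among the perfect
  matchings (the conclusion of `stub_even`).

The standard target enters only through its defining filter (so the statements apply to the line's
`kstd n` by `rfl`). All statements over `ℂ` and `Fin n`; no new definitions.
-/

noncomputable section

namespace Summit.ValiantsHypothesis.PolyaContinued

open MvPolynomial Finset Literature.Combinatorics.SimpleGraph Equiv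

variable {n : ℕ}

/-! ### (G1) Normal form for the standard target -/

/-- The matching `κ ρ⁻¹` lies inside `relabel K ρ κ` whenever the diagonal lies inside `K`.
[folklore] -/
theorem symm_trans_mem_relabel {K : Finset (Fin n × Fin n)} (hK : ∀ i, (i, i) ∈ K)
    (ρ κ : Perm (Fin n)) (i : Fin n) : (i, (ρ.symm.trans κ) i) ∈ relabel K ρ κ := by
  rw [mem_relabel_iff]
  simpa using hK (ρ.symm i)

/-- **(G1) Normal form for the standard target.** A label identity onto `relabel (kstd n) ρ κ`
(`kstd n` given by its defining filter) with `n ≥ 3` can be replaced by one from a source `H'`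
containing the diagonal, with `φ' (x, x) = (x, x)`, onto a target of shape "`K_{3,3}` on a `3`-set
`A` plus the diagonal"; `H` is Pfaffian iff `H'` is, and every cell multiplicity of `H` is a cell
multiplicity of `H'`. [folklore] -/
theorem exists_normalForm_kstd {H : Finset (Fin n × Fin n)} {φ : Fin n × Fin n → Fin n × Fin n}
    {ρ κ : Perm (Fin n)} (hn : 3 ≤ n)
    (hid : (∑ σ : Equiv.Perm (Fin n), if (∀ i, (i, σ i) ∈ H) then
        ∏ i, (X (φ (i, σ i)) : MvPolynomial (Fin n × Fin n) ℂ) else 0) =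
      perfectMatchingPoly (relabel (Finset.univ.filter fun e : Fin n × Fin n =>
        ((e.1 : ℕ) < 3 ∧ (e.2 : ℕ) < 3) ∨ (e.1 = e.2 ∧ 3 ≤ (e.1 : ℕ))) ρ κ) ℂ) :
    ∃ (H' E' : Finset (Fin n × Fin n)) (φ' : Fin n × Fin n → Fin n × Fin n) (A : Finset (Fin n)),
      (IsPfaffianBipartite H ↔ IsPfaffianBipartite H') ∧ (∀ x, (x, x) ∈ H') ∧
      (∀ x, φ' (x, x) = (x, x)) ∧
      (∑ σ : Equiv.Perm (Fin n), if (∀ i, (i, σ i) ∈ H') then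
          ∏ i, (X (φ' (i, σ i)) : MvPolynomial (Fin n × Fin n) ℂ) else 0) =
        perfectMatchingPoly E' ℂ ∧
      (∀ x y, (x, y) ∈ E' ↔ (x ∈ A ∧ y ∈ A) ∨ x = y) ∧ A.card = 3 ∧
      (∀ i j : Fin n, ∃ x y : Fin n,
        (Finset.univ.filter fun σ : Perm (Fin n) => (∀ k, (k, σ k) ∈ H) ∧ σ i = j).card =
          (Finset.univ.filter fun σ : Perm (Fin n) => (∀ k, (k, σ k) ∈ H') ∧ σ x = y).card) := by
  classical
  set K : Finset (Fin n × Fin n) := Finset.univ.filter fun e : Fin n × Fin n =>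
    ((e.1 : ℕ) < 3 ∧ (e.2 : ℕ) < 3) ∨ (e.1 = e.2 ∧ 3 ≤ (e.1 : ℕ)) with hK
  have hKd : ∀ i, (i, i) ∈ K := fun i => by
    rw [hK, Finset.mem_filter]
    refine ⟨Finset.mem_univ _, ?_⟩
    by_cases hi : ((i : Fin n) : ℕ) < 3
    · exact Or.inl ⟨hi, hi⟩
    · exact Or.inr ⟨rfl, not_lt.1 hi⟩
  obtain ⟨H', φ', hP, hD, hφ', hid', hmult⟩ :=
    exists_normalForm_of_isPerfectMatching hid (symm_trans_mem_relabel hKd ρ κ)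
  rw [relabel_relabel_refl_symm_trans] at hid'
  exact ⟨H', relabel K ρ ρ, φ', Finset.univ.filter fun x : Fin n => ((ρ.symm x : Fin n) : ℕ) < 3,
    hP, hD, hφ', hid', fun x y => mem_relabel_filter_kstd_iff ρ x y,
    card_filter_symm_lt_three ρ hn, hmult⟩

/-! ### (G2) The five dicircuits of the normalised source -/

section Normalised

variable {H E : Finset (Fin n × Fin n)} {φ : Fin n × Fin n → Fin n × Fin n} {A : Finset (Fin n)}

/-- (G2a) In the normalised setting the source has exactly five non-identity perfect matchings —
the five dicircuits of `D(H)`. [folklore] -/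
theorem card_filter_ne_one_eq_five
    (hid : (∑ σ : Equiv.Perm (Fin n), if (∀ i, (i, σ i) ∈ H) then
        ∏ i, (X (φ (i, σ i)) : MvPolynomial (Fin n × Fin n) ℂ) else 0) =
      perfectMatchingPoly E ℂ)
    (hHd : ∀ i, (i, i) ∈ H) (hE : ∀ x y, (x, y) ∈ E ↔ (x ∈ A ∧ y ∈ A) ∨ x = y)
    (hA : A.card = 3) :
    (Finset.univ.filter fun σ : Perm (Fin n) => (∀ i, (i, σ i) ∈ H) ∧ σ ≠ 1).card = 5 := by
  have h := card_filter_isPerfectMatching_ne_one hHd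
  rw [card_filter_isPerfectMatching_eq hid, card_filter_isPerfectMatching_eq_six hE hA] at h
  omega

/-- Every non-identity perfect matching of the normalised source is a dicircuit. [folklore] -/
theorem isCycle_of_isPerfectMatching_of_ne_one
    (hid : (∑ σ : Equiv.Perm (Fin n), if (∀ i, (i, σ i) ∈ H) then
        ∏ i, (X (φ (i, σ i)) : MvPolynomial (Fin n × Fin n) ℂ) else 0) =
      perfectMatchingPoly E ℂ)
    (hφ : ∀ i, φ (i, i) = (i, i)) (hHd : ∀ i, (i, i) ∈ H)
    (hE : ∀ x y, (x, y) ∈ E ↔ (x ∈ A ∧ y ∈ A) ∨ x = y) (hA : A.card = 3)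
    {σ : Perm (Fin n)} (hσ : ∀ i, (i, σ i) ∈ H) (hne : σ ≠ 1) : σ.IsCycle :=
  isCycle_of_ne_one hid hφ hHd (fun π hπ hπ1 =>
    isCycle_of_support_subset hA ((isPerfectMatching_iff_support_subset hE π).1 hπ) hπ1) hσ hne

/-- Any two distinct perfect matchings of the normalised source differ by a single cycle.
[folklore] -/
theorem isCycle_inv_mul_of_isPerfectMatching
    (hid : (∑ σ : Equiv.Perm (Fin n), if (∀ i, (i, σ i) ∈ H) then
        ∏ i, (X (φ (i, σ i)) : MvPolynomial (Fin n × Fin n) ℂ) else 0) =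
      perfectMatchingPoly E ℂ)
    (hE : ∀ x y, (x, y) ∈ E ↔ (x ∈ A ∧ y ∈ A) ∨ x = y) (hA : A.card = 3)
    {σ σ' : Perm (Fin n)} (hσ : ∀ i, (i, σ i) ∈ H) (hσ' : ∀ i, (i, σ' i) ∈ H) (hne : σ ≠ σ') :
    (σ⁻¹ * σ').IsCycle :=
  isCycle_inv_mul_of_ne hid (fun π π' hπ hπ' hππ' => isCycle_inv_mul_of_support_subset hA
    ((isPerfectMatching_iff_support_subset hE π).1 hπ)
    ((isPerfectMatching_iff_support_subset hE π').1 hπ') hππ') hσ hσ' hne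

/-- **Splice closure.** A cyclic permutation moving every point along `μ`, along `ν` or not at
all, where `μ, ν` are perfect matchings of the source (containing the diagonal), is one of the
non-identity perfect matchings. [folklore] -/
theorem mem_filter_of_isCycle_of_forall_apply (hHd : ∀ i, (i, i) ∈ H) {μ ν c : Perm (Fin n)}
    (hμ : ∀ i, (i, μ i) ∈ H) (hν : ∀ i, (i, ν i) ∈ H) (hc : c.IsCycle)
    (hcv : ∀ v, c v = μ v ∨ c v = ν v ∨ c v = v) :
    c ∈ Finset.univ.filter fun σ : Perm (Fin n) => (∀ i, (i, σ i) ∈ H) ∧ σ ≠ 1 :=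
  Finset.mem_filter.2 ⟨Finset.mem_univ _, isPerfectMatching_of_forall_apply_mem hHd hμ hν hcv,
    hc.ne_one⟩

/-- **(G2b) The lifted fork pair.** In the normalised setting there are two distinct dicircuits
`γ₊ ≠ γ₋` of `D(H)` (non-identity perfect matchings of `H`) whose images `δ₊, δ₋` in the target have
at least three forks (points moved by both, to different places). [folklore] -/
theorem exists_lifted_fork_pair
    (hid : (∑ σ : Equiv.Perm (Fin n), if (∀ i, (i, σ i) ∈ H) then
        ∏ i, (X (φ (i, σ i)) : MvPolynomial (Fin n × Fin n) ℂ) else 0) =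
      perfectMatchingPoly E ℂ)
    (hφ : ∀ i, φ (i, i) = (i, i)) (hHd : ∀ i, (i, i) ∈ H)
    (hE : ∀ x y, (x, y) ∈ E ↔ (x ∈ A ∧ y ∈ A) ∨ x = y) (hA : A.card = 3) :
    ∃ γp γm δp δm : Perm (Fin n), (∀ i, (i, γp i) ∈ H) ∧ (∀ i, (i, γm i) ∈ H) ∧
      γp ≠ 1 ∧ γm ≠ 1 ∧ γp ≠ γm ∧ γp.IsCycle ∧ γm.IsCycle ∧
      (∑ i, Finsupp.single (φ (i, γp i)) 1 : (Fin n × Fin n) →₀ ℕ) = matchingExponent δp ∧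
      (∑ i, Finsupp.single (φ (i, γm i)) 1 : (Fin n × Fin n) →₀ ℕ) = matchingExponent δm ∧
      3 ≤ ((δp.support ∩ δm.support).filter fun x => δp x ≠ δm x).card := by
  obtain ⟨δp, δm, hδp, hδm, hp1, hm1, hpm, hforks⟩ := exists_three_forks hE hA
  obtain ⟨γp, hγp, hγpδ⟩ := exists_preimage_of_labelIdentity hid hδp
  obtain ⟨γm, hγm, hγmδ⟩ := exists_preimage_of_labelIdentity hid hδm
  have h1 : ∀ i, (i, (1 : Perm (Fin n)) i) ∈ H := fun i => by simpa using hHd i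
  have hγp1 : γp ≠ 1 := by
    rintro rfl
    exact hp1 (matchingExponent_injective (hγpδ.symm.trans (labelExponent_one hφ)))
  have hγm1 : γm ≠ 1 := by
    rintro rfl
    exact hm1 (matchingExponent_injective (hγmδ.symm.trans (labelExponent_one hφ)))
  have hγpm : γp ≠ γm := by
    rintro rfl
    exact hpm (matchingExponent_injective (hγpδ.symm.trans hγmδ))
  exact ⟨γp, γm, δp, δm, hγp, hγm, hγp1, hγm1, hγpm,
    isCycle_of_isPerfectMatching_of_ne_one hid hφ hHd hE hA hγp hγp1,
    isCycle_of_isPerfectMatching_of_ne_one hid hφ hHd hE hA hγm hγm1, hγpδ, hγmδ, hforks⟩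

end Normalised

/-! ### (G3) Even multiplicities from even arc coverage -/

/-- **(G3) Even arc coverage gives even cell multiplicities.** Let `H ⊇ diagonal` have an ODD number
of non-identity perfect matchings (dicircuits), and suppose every off-diagonal cell `(a, b)` lies on
an even number of them. Then EVERY cell of `K_{n,n}` lies in an even number of perfect matchings
of `H`: off the diagonal this is the hypothesis; a diagonal cell `(a, a)` lies in the identity and
in the dicircuits avoiding `a`, whose number is odd minus the (even) number of dicircuits through
`a`. This is the form of (EVEN) consumed by `stub_even` of the line `even_induction`. [folklore] -/
theorem even_multiplicity_of_even_cover {H : Finset (Fin n × Fin n)} (hHd : ∀ i, (i, i) ∈ H)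
    (hodd : Odd (Finset.univ.filter fun σ : Perm (Fin n) => (∀ i, (i, σ i) ∈ H) ∧ σ ≠ 1).card)
    (hcov : ∀ a b : Fin n, a ≠ b → Even (Finset.univ.filter fun σ : Perm (Fin n) =>
      ((∀ i, (i, σ i) ∈ H) ∧ σ ≠ 1) ∧ σ a = b).card)
    (c : Fin n × Fin n) :
    Even (Finset.univ.filter fun σ : Perm (Fin n) => (∀ i, (i, σ i) ∈ H) ∧ σ c.1 = c.2).card := by
  classical
  obtain ⟨a, b⟩ := c
  simp only
  by_cases hab : a = b
  · subst hab
    -- split off the identity matching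
    set S := Finset.univ.filter fun σ : Perm (Fin n) => (∀ i, (i, σ i) ∈ H) ∧ σ ≠ 1 with hS
    have h1 : (Finset.univ.filter fun σ : Perm (Fin n) => (∀ i, (i, σ i) ∈ H) ∧ σ a = a) =
        insert 1 (S.filter fun σ => σ a = a) := by
      ext σ
      simp only [hS, Finset.mem_filter, Finset.mem_univ, true_and, Finset.mem_insert]
      constructor
      · rintro ⟨hσ, hσa⟩
        by_cases h : σ = 1
        · exact Or.inl h
        · exact Or.inr ⟨⟨hσ, h⟩, hσa⟩
      · rintro (rfl | ⟨⟨hσ, -⟩, hσa⟩)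
        · exact ⟨fun i => by simpa using hHd i, rfl⟩
        · exact ⟨hσ, hσa⟩
    have hnot : (1 : Perm (Fin n)) ∉ S.filter fun σ => σ a = a := by
      simp [hS]
    rw [h1, Finset.card_insert_of_notMem hnot]
    -- dicircuits avoiding `a` = all dicircuits minus those through `a`
    have hsplit : (S.filter fun σ => σ a = a).card + (S.filter fun σ => σ a ≠ a).card = S.card :=
      Finset.card_filter_add_card_filter_not _
    -- dicircuits through `a`, grouped by the value `σ a ≠ a`: an even number
    have hthrough : Even (S.filter fun σ => σ a ≠ a).card := by
      rw [Finset.card_eq_sum_card_fiberwise (f := fun σ : Perm (Fin n) => σ a)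
        (t := Finset.univ.erase a) (fun σ hσ => by
          have h := (Finset.mem_filter.1 (Finset.mem_coe.1 hσ)).2
          exact Finset.mem_coe.2 (Finset.mem_erase.2 ⟨h, Finset.mem_univ _⟩))]
      refine Finset.even_sum _ fun b hb => ?_
      have hba : a ≠ b := (Finset.ne_of_mem_erase hb).symm
      have heq : ((S.filter fun σ => σ a ≠ a).filter fun σ => σ a = b) =
          Finset.univ.filter fun σ : Perm (Fin n) => ((∀ i, (i, σ i) ∈ H) ∧ σ ≠ 1) ∧ σ a = b := by
        ext σ
        simp only [hS, Finset.mem_filter, Finset.mem_univ, true_and]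
        constructor
        · rintro ⟨⟨h1, -⟩, h3⟩; exact ⟨h1, h3⟩
        · rintro ⟨h1, h3⟩; exact ⟨⟨h1, by rw [h3]; exact hba.symm⟩, h3⟩
      rw [heq]
      exact hcov a b hba
    -- parity bookkeeping: `1 + (odd - even)` is even
    obtain ⟨k, hk⟩ := hodd
    obtain ⟨m, hm⟩ := hthrough
    have : (S.filter fun σ => σ a = a).card = 2 * k + 1 - (m + m) := by omega
    rw [Nat.even_add_one, Nat.not_even_iff_odd]
    exact ⟨k - m, by omega⟩
  · have heq : (Finset.univ.filter fun σ : Perm (Fin n) => (∀ i, (i, σ i) ∈ H) ∧ σ a = b) =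
        Finset.univ.filter fun σ : Perm (Fin n) => ((∀ i, (i, σ i) ∈ H) ∧ σ ≠ 1) ∧ σ a = b := by
      ext σ
      simp only [Finset.mem_filter, Finset.mem_univ, true_and]
      constructor
      · rintro ⟨h1, h3⟩
        refine ⟨⟨h1, ?_⟩, h3⟩
        rintro rfl
        exact hab (by simpa using h3)
      · rintro ⟨⟨h1, -⟩, h3⟩; exact ⟨h1, h3⟩
    rw [heq]
    exact hcov a b hab

end Summit.ValiantsHypothesis.PolyaContinued
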